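import Mathlib
import Summits.ValiantsHypothesis.ValiantsHypothesis.Theorems.NewtonUnitEquationsDissociatedUniformTotalsLaw
import Summits.ValiantsHypothesis.ValiantsHypothesis.Theorems.NewtonUnitEquationsDissociatedUniformTotalsLawConstant
import Summits.ValiantsHypothesis.ValiantsHypothesis.Theorems.NewtonUnitEquationsDissociatedUniformTotalsLawSharpness
import Literature.Computability.AlgebraicComplexity.NewtonPolygonTauProductBounds
import HarnessLib

/-!
# Crux `NewtonUnitEquations.DissociatedUniform` (stmt-ValiantsHypothesis-5905): the `n = 3` totals law — the UNION-OF-FIBRES sub-law, typed and located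

Companion of `…DissociatedUniformTotalsLaw` (the `n = 3` law `TotalsLawThree C : T(a,b,c) ≤ C·|G|²`, OPEN for `C ≥ 3`,
refuted for `C ≤ 2` by `…TotalsLawQuaternary`).  Memo `Cruxes/DissociatedUniform/NOTES-t1.md` §5(ii) / `NOTES-t1g2.md` §3(i)
single out the "cleanest open sub-statement" of the law: the totals of UNIONS OF FIBRES of one pair sumset.  With
`P_r = {a x + b (r - x)}` the fibres of `A + B` and `Z ⊆ G` a set of positions put
`U_s(Z) := ⋃_{z ∈ Z} P_{s - z} = {a x + b y : s - x - y ∈ Z}` (the part of class `s` carried by the positions `z ∈ Z` when the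
third curve vanishes there).  The **union totals law** `UnionTotalsLaw C` says `∑_s #vert conv U_s(Z) ≤ C·|G|²` for every
finite abelian `G`, all `a b` and every `Z`.

What is here (all kernel-checked; the two laws themselves stay conjecture-grade `def`s, asserted nowhere):
* `unionPts a b Z s = U_s(Z)`, `unionVert`, `unionTotal a b Z = ∑_s #vert conv U_s(Z)`, `@[conjecture] UnionTotalsLaw C`, and the
  two-valued stratum of the `n = 3` law `@[conjecture] TwoValuedTotalsLaw C` (third curve with at most two values).
* ENVELOPE: `U_s(univ) = A + B` (so `unionVert ≤ 2|G|` there, Minkowski), `U_s({z}) = P_{s-z}`, `unionVert ≤ ∑_{z∈Z} V(P_{s-z}) ≤ |Z|·|G|`,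
  `unionVert ≤ |G|²`; `¬ UnionTotalsLaw 1` (unit square over `ZMod 2`, `Z = univ`: total `8 > 4`), so `UnionTotalsLaw C → 2 ≤ C`.
* ADDITIVE STRATUM (companion file `…TotalsLawUnionCosets`): for `Z` a COSET of a subgroup `H ≤ G`, `#vert conv U_s(Z) ≤ 2|G|`
  for every `s`, and a third curve constant on the cosets of `H` has `V_s ≤ 2|G|·[G:H]`.
* LEVEL-SET DECOMPOSITION (every `c`): `class_s = ⋃_{v ∈ c(G)} (v + U_s(c⁻¹ v))`, hence `V_s ≤ ∑_v #vert conv U_s(c⁻¹ v)` and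
  `T(a,b,c) ≤ ∑_v unionTotal a b (c⁻¹ v)`; so **`UnionTotalsLaw C` implies the `n = 3` law on the `m`-valued stratum with
  constant `m·C`**, in particular `UnionTotalsLaw C → TwoValuedTotalsLaw (2C)` — and `TotalsLawThree C → TwoValuedTotalsLaw C`
  trivially.  The converse `TwoValuedTotalsLaw C → UnionTotalsLaw (2C)` (far shifts `±(L, 0)` expose every vertex of `U_s(Z)`
  in one of two two-valued classes) is the companion file `…TotalsLawUnionConverse`; together: the union totals law IS the
  two-valued stratum of the `n = 3` law, up to a factor `2` in the constant.
Honest label: structure / location only; `UnionTotalsLaw`, `TwoValuedTotalsLaw`, `TotalsLawThree` remain OPEN; nothing here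
bears on VP ≠ VNP.
[folklore: extreme points of the hull of a finite set lie in the set; hull vertices of a union are hull vertices of the parts]
-/

set_option linter.dupNamespace false -- `ValiantsHypothesis.ValiantsHypothesis` (summit = problem) in every name

open scoped BigOperators Pointwise

namespace Summit.ValiantsHypothesis.ValiantsHypothesis.Theorems.NewtonUnitEquationsDissociatedUniform

namespace TotalsLaw

open Literature.Computability.AlgebraicComplexity.KPTT.PlanarMinkowski

variable {G : Type*} [AddCommGroup G] [Fintype G]

/-! ### Unions of fibres -/

/-- `U_s(Z) = ⋃_{z ∈ Z} P_{s-z}`: the union of the fibres of the pair sumset `A + B` sitting at the positions `z ∈ Z` of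
class `s` (equivalently `{a x + b y : s - x - y ∈ Z}`). -/
def unionPts (a b : G → (Fin 2 → ℝ)) (Z : Set G) (s : G) : Set (Fin 2 → ℝ) :=
  ⋃ z ∈ Z, fibrePts a b (s - z)

/-- `#vert conv U_s(Z)`. -/
noncomputable def unionVert (a b : G → (Fin 2 → ℝ)) (Z : Set G) (s : G) : ℕ :=
  (Set.extremePoints ℝ (convexHull ℝ (unionPts a b Z s))).ncard

/-- The union total `∑_s #vert conv U_s(Z)` of the position set `Z`. -/
noncomputable def unionTotal (a b : G → (Fin 2 → ℝ)) (Z : Set G) : ℕ :=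
  ∑ s, unionVert a b Z s

/-- **The union-of-fibres totals law with constant `C`** (conjecture-grade, OPEN; memo NOTES-t1 §5(ii): census `1.5–1.7·q²`
for `|Z| = q/2` under short annealing, `q = 8…16`; single unions exceed `2q`): for every finite abelian `G`, all `a b : G → ℝ²`
and every position set `Z ⊆ G`, `∑_s #vert conv (⋃_{z∈Z} P_{s-z}) ≤ C·|G|²`.  Not asserted anywhere. -/
@[conjecture] def UnionTotalsLaw (C : ℕ) : Prop :=
  ∀ (G : Type) [AddCommGroup G] [Fintype G] (a b : G → (Fin 2 → ℝ)) (Z : Set G),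
    unionTotal a b Z ≤ C * Fintype.card G ^ 2

/-- **The two-valued stratum of the `n = 3` totals law** (conjecture-grade, OPEN): `T(a,b,c) ≤ C·|G|²` whenever the third
curve `c` takes at most two values.  Not asserted anywhere. -/
@[conjecture] def TwoValuedTotalsLaw (C : ℕ) : Prop :=
  ∀ (G : Type) [AddCommGroup G] [Fintype G] (a b c : G → (Fin 2 → ℝ)) (v₀ v₁ : Fin 2 → ℝ),
    (∀ z, c z = v₀ ∨ c z = v₁) → totalVert a b c ≤ C * Fintype.card G ^ 2

omit [Fintype G] in
/-- Membership in a fibre union: `p ∈ U_s(Z) ↔ p = a x + b y` with `s - x - y ∈ Z`. [folklore] -/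
theorem mem_unionPts {a b : G → (Fin 2 → ℝ)} {Z : Set G} {s : G} {p : Fin 2 → ℝ} :
    p ∈ unionPts a b Z s ↔ ∃ x y : G, s - x - y ∈ Z ∧ p = a x + b y := by
  simp only [unionPts, fibrePts, Set.mem_iUnion, Set.mem_range, exists_prop]
  constructor
  · rintro ⟨z, hz, x, rfl⟩
    exact ⟨x, s - z - x, by rwa [show s - x - (s - z - x) = z by abel], rfl⟩
  · rintro ⟨x, y, hxy, rfl⟩
    exact ⟨s - x - y, hxy, x, by rw [show s - (s - x - y) - x = y by abel]⟩

omit [Fintype G] in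
/-- `U_s(Z)` lies in the pair sumset (as the range over `G × G`). [folklore] -/
theorem unionPts_subset_range (a b : G → (Fin 2 → ℝ)) (Z : Set G) (s : G) :
    unionPts a b Z s ⊆ Set.range (fun p : G × G => a p.1 + b p.2) := by
  intro p hp
  obtain ⟨x, y, -, rfl⟩ := mem_unionPts.1 hp
  exact ⟨(x, y), rfl⟩

/-- `U_s(Z)` is finite. [folklore] -/
theorem unionPts_finite (a b : G → (Fin 2 → ℝ)) (Z : Set G) (s : G) : (unionPts a b Z s).Finite :=
  (Set.finite_range _).subset (unionPts_subset_range a b Z s)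

omit [Fintype G] in
/-- All positions: `U_s(G) = A + B` for every class `s`. [folklore] -/
theorem unionPts_univ (a b : G → (Fin 2 → ℝ)) (s : G) :
    unionPts a b Set.univ s = Set.range a + Set.range b := by
  ext p
  rw [mem_unionPts, Set.mem_add]
  constructor
  · rintro ⟨x, y, -, rfl⟩
    exact ⟨a x, ⟨x, rfl⟩, b y, ⟨y, rfl⟩, rfl⟩
  · rintro ⟨_, ⟨x, rfl⟩, _, ⟨y, rfl⟩, rfl⟩
    exact ⟨x, y, Set.mem_univ _, rfl⟩

omit [Fintype G] in
/-- One position: `U_s({z}) = P_{s-z}`. [folklore] -/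
theorem unionPts_singleton (a b : G → (Fin 2 → ℝ)) (z s : G) :
    unionPts a b {z} s = fibrePts a b (s - z) := by
  simp [unionPts]

omit [Fintype G] in
/-- Monotonicity in the position set. [folklore] -/
theorem unionPts_mono (a b : G → (Fin 2 → ℝ)) {Z Z' : Set G} (h : Z ⊆ Z') (s : G) :
    unionPts a b Z s ⊆ unionPts a b Z' s := by
  intro p hp
  obtain ⟨x, y, hxy, rfl⟩ := mem_unionPts.1 hp
  exact mem_unionPts.2 ⟨x, y, h hxy, rfl⟩

omit [Fintype G] in
/-- Unions of position sets give unions of fibre unions. [folklore] -/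
theorem unionPts_union (a b : G → (Fin 2 → ℝ)) (Z Z' : Set G) (s : G) :
    unionPts a b (Z ∪ Z') s = unionPts a b Z s ∪ unionPts a b Z' s := by
  ext p
  simp only [Set.mem_union, mem_unionPts]
  constructor
  · rintro ⟨x, y, hxy | hxy, rfl⟩
    · exact Or.inl ⟨x, y, hxy, rfl⟩
    · exact Or.inr ⟨x, y, hxy, rfl⟩
  · rintro (⟨x, y, hxy, rfl⟩ | ⟨x, y, hxy, rfl⟩)
    · exact ⟨x, y, Or.inl hxy, rfl⟩
    · exact ⟨x, y, Or.inr hxy, rfl⟩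

/-! ### Envelope -/

/-- `#vert conv U_s(Z) ≤ |G|²`. [folklore] -/
theorem unionVert_le_card_sq (a b : G → (Fin 2 → ℝ)) (Z : Set G) (s : G) :
    unionVert a b Z s ≤ Fintype.card G ^ 2 := by
  unfold unionVert
  calc (Set.extremePoints ℝ (convexHull ℝ (unionPts a b Z s))).ncard
      ≤ (unionPts a b Z s).ncard := Set.ncard_le_ncard extremePoints_convexHull_subset (unionPts_finite a b Z s)
    _ ≤ (Set.range fun p : G × G => a p.1 + b p.2).ncard :=
        Set.ncard_le_ncard (unionPts_subset_range a b Z s) (Set.finite_range _)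
    _ ≤ Fintype.card (G × G) := ncard_range_le_card _
    _ = Fintype.card G ^ 2 := by rw [Fintype.card_prod, sq]

/-- Hence `unionTotal ≤ |G|³`. [folklore] -/
theorem unionTotal_le_card_cube (a b : G → (Fin 2 → ℝ)) (Z : Set G) :
    unionTotal a b Z ≤ Fintype.card G ^ 3 := by
  unfold unionTotal
  calc ∑ s, unionVert a b Z s ≤ ∑ _s : G, Fintype.card G ^ 2 :=
        Finset.sum_le_sum fun s _ => unionVert_le_card_sq a b Z s
    _ = Fintype.card G ^ 3 := by rw [Finset.sum_const, Finset.card_univ, smul_eq_mul]; ring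

/-- All positions: `#vert conv U_s(G) = #vert conv (A + B) ≤ 2|G|` (planar Minkowski bound). [folklore] -/
theorem unionVert_univ_le (a b : G → (Fin 2 → ℝ)) (s : G) :
    unionVert a b Set.univ s ≤ 2 * Fintype.card G := by
  unfold unionVert
  rw [unionPts_univ]
  have hA : ((convexHull ℝ (Set.range a)).extremePoints ℝ).ncard ≤ Fintype.card G :=
    (Set.ncard_le_ncard extremePoints_convexHull_subset (Set.finite_range a)).trans (ncard_range_le_card a)
  have hB : ((convexHull ℝ (Set.range b)).extremePoints ℝ).ncard ≤ Fintype.card G :=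
    (Set.ncard_le_ncard extremePoints_convexHull_subset (Set.finite_range b)).trans (ncard_range_le_card b)
  calc ((convexHull ℝ (Set.range a + Set.range b)).extremePoints ℝ).ncard
      ≤ ((convexHull ℝ (Set.range a)).extremePoints ℝ).ncard + ((convexHull ℝ (Set.range b)).extremePoints ℝ).ncard :=
        ncard_extremePoints_range_add_le a b
    _ ≤ Fintype.card G + Fintype.card G := add_le_add hA hB
    _ = 2 * Fintype.card G := (two_mul _).symm

/-- Hence `unionTotal a b univ ≤ 2|G|²` (the union totals law with `C = 2` holds at `Z = G`). [folklore] -/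
theorem unionTotal_univ_le (a b : G → (Fin 2 → ℝ)) :
    unionTotal a b Set.univ ≤ 2 * Fintype.card G ^ 2 := by
  unfold unionTotal
  calc ∑ s, unionVert a b Set.univ s ≤ ∑ _s : G, 2 * Fintype.card G :=
        Finset.sum_le_sum fun s _ => unionVert_univ_le a b s
    _ = 2 * Fintype.card G ^ 2 := by rw [Finset.sum_const, Finset.card_univ, smul_eq_mul]; ring

omit [Fintype G] in
/-- `U_s(univ)` has the vertex count of a class with a vanishing third curve. [folklore] -/
theorem unionVert_univ_eq_classVert_zero (a b : G → (Fin 2 → ℝ)) (s : G) :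
    unionVert a b Set.univ s = classVert a b (fun _ => (0 : Fin 2 → ℝ)) s := by
  unfold unionVert classVert
  rw [unionPts_univ, classPts_const_eq_vadd, zero_vadd]

/-- A fibre union has at most `∑_{z ∈ Z} V(P_{s-z})` hull vertices (a vertex of a union is a vertex of its own part). [folklore] -/
theorem unionVert_le_sum_fibreVert (a b : G → (Fin 2 → ℝ)) (Z : Finset G) (s : G) :
    unionVert a b (Z : Set G) s ≤ ∑ z ∈ Z, fibreVert a b (s - z) := by
  classical
  set P : G → Finset (Fin 2 → ℝ) := fun r => Finset.univ.image fun x : G => a x + b (r - x) with hP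
  have hPcoe : ∀ r, (P r : Set (Fin 2 → ℝ)) = fibrePts a b r := by
    intro r
    rw [hP, Finset.coe_image, Finset.coe_univ, Set.image_univ]
    rfl
  have hU : unionPts a b (Z : Set G) s = ((Z.biUnion fun z => P (s - z) : Finset (Fin 2 → ℝ)) : Set (Fin 2 → ℝ)) := by
    rw [Finset.coe_biUnion]
    unfold unionPts
    exact Set.iUnion₂_congr fun z _ => (hPcoe (s - z)).symm
  unfold unionVert
  rw [hU]
  refine (ncard_extremePoints_biUnion_le Z fun z => P (s - z)).trans (Finset.sum_le_sum fun z _ => ?_)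
  unfold fibreVert
  rw [hPcoe]

/-- Hence `#vert conv U_s(Z) ≤ |Z|·|G|`. [folklore] -/
theorem unionVert_le_card_mul (a b : G → (Fin 2 → ℝ)) (Z : Finset G) (s : G) :
    unionVert a b (Z : Set G) s ≤ Z.card * Fintype.card G := by
  calc unionVert a b (Z : Set G) s ≤ ∑ z ∈ Z, fibreVert a b (s - z) := unionVert_le_sum_fibreVert a b Z s
    _ ≤ ∑ _z ∈ Z, Fintype.card G := Finset.sum_le_sum fun z _ => fibreVert_le_card a b (s - z)
    _ = Z.card * Fintype.card G := by rw [Finset.sum_const, smul_eq_mul]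

/-- And `unionTotal a b Z ≤ |Z|·|G|²` (so the union totals law is only in question for `|Z| → ∞`). [folklore] -/
theorem unionTotal_le_card_mul (a b : G → (Fin 2 → ℝ)) (Z : Finset G) :
    unionTotal a b (Z : Set G) ≤ Z.card * Fintype.card G ^ 2 := by
  unfold unionTotal
  calc ∑ s, unionVert a b (Z : Set G) s ≤ ∑ _s : G, Z.card * Fintype.card G :=
        Finset.sum_le_sum fun s _ => unionVert_le_card_mul a b Z s
    _ = Z.card * Fintype.card G ^ 2 := by rw [Finset.sum_const, Finset.card_univ, smul_eq_mul]; ring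

/-! ### Sharpness: the constant is at least `2` -/

/-- The union totals law is monotone in its constant. -/
theorem unionTotalsLaw_mono {C C' : ℕ} (hCC' : C ≤ C') (h : UnionTotalsLaw C) : UnionTotalsLaw C' :=
  fun G _ _ a b Z => (h G a b Z).trans (Nat.mul_le_mul_right _ hCC')

/-- **`¬ UnionTotalsLaw 1`**: over `ZMod 2` with the unit-square letters (`…TotalsLawSharpness.sqA/sqB`) and `Z = univ`
both unions are the unit square, total `8 > 1·2²`. -/
theorem not_unionTotalsLaw_one : ¬ UnionTotalsLaw 1 := by
  intro h
  have hT := h (ZMod 2) sqA sqB Set.univ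
  have h8 : 8 ≤ unionTotal sqA sqB (Set.univ : Set (ZMod 2)) := by
    unfold unionTotal
    calc 8 = ∑ _s : ZMod 2, 4 := by simp
      _ ≤ ∑ s : ZMod 2, unionVert sqA sqB Set.univ s := Finset.sum_le_sum fun s _ =>
          (four_le_classVert s).trans_eq (unionVert_univ_eq_classVert_zero sqA sqB s).symm
  have hcard : Fintype.card (ZMod 2) = 2 := ZMod.card 2
  rw [hcard] at hT
  omega

/-- Hence any valid constant of the union totals law is at least `2` (and `C = 2` is attained at `Z = univ` by
`unionTotal_univ_le`). -/
theorem two_le_of_unionTotalsLaw {C : ℕ} (h : UnionTotalsLaw C) : 2 ≤ C := by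
  by_contra hC
  exact not_unionTotalsLaw_one (unionTotalsLaw_mono (by omega) h)

/-! ### Level-set decomposition of a class -/

omit [Fintype G] in
/-- **Level sets.**  `class_s(a,b,c) = ⋃_{v ∈ c(G)} (v + U_s(c⁻¹ v))`: the blobs `c z + P_{s-z}` grouped by the value of `c`.
[folklore] -/
theorem classPts_eq_iUnion_vadd_unionPts (a b c : G → (Fin 2 → ℝ)) (s : G) :
    classPts a b c s = ⋃ v ∈ Set.range c, v +ᵥ unionPts a b (c ⁻¹' {v}) s := by
  ext p
  simp only [classPts, Set.mem_range, Prod.exists, Set.mem_iUnion, exists_prop, Set.mem_vadd_set, mem_unionPts,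
    Set.mem_preimage, Set.mem_singleton_iff, vadd_eq_add]
  constructor
  · rintro ⟨x, y, rfl⟩
    exact ⟨c (s - x - y), ⟨s - x - y, rfl⟩, a x + b y, ⟨x, y, rfl, rfl⟩, by abel⟩
  · rintro ⟨v, -, q, ⟨x, y, hz, rfl⟩, rfl⟩
    exact ⟨x, y, by rw [hz]; abel⟩

/-- **`V_s ≤ ∑_{v ∈ c(G)} #vert conv U_s(c⁻¹ v)`** (a vertex of the union is a vertex of its own translated part;
translations preserve vertex counts). [folklore] -/
theorem classVert_le_sum_unionVert (a b c : G → (Fin 2 → ℝ)) (s : G) [DecidableEq (Fin 2 → ℝ)] :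
    classVert a b c s ≤ ∑ v ∈ Finset.univ.image c, unionVert a b (c ⁻¹' {v}) s := by
  classical
  set F : (Fin 2 → ℝ) → Finset (Fin 2 → ℝ) :=
    fun v => (unionPts_finite a b (c ⁻¹' {v}) s).toFinset.image fun p => v +ᵥ p with hF
  have hFcoe : ∀ v, (F v : Set (Fin 2 → ℝ)) = v +ᵥ unionPts a b (c ⁻¹' {v}) s := by
    intro v
    rw [hF, Finset.coe_image, Set.Finite.coe_toFinset, Set.image_vadd]
  have hclass : classPts a b c s =
      (((Finset.univ.image c).biUnion F : Finset (Fin 2 → ℝ)) : Set (Fin 2 → ℝ)) := by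
    rw [classPts_eq_iUnion_vadd_unionPts, Finset.coe_biUnion]
    have hrange : ((Finset.univ.image c : Finset (Fin 2 → ℝ)) : Set (Fin 2 → ℝ)) = Set.range c := by
      rw [Finset.coe_image, Finset.coe_univ, Set.image_univ]
    rw [hrange]
    exact Set.iUnion₂_congr fun v _ => (hFcoe v).symm
  unfold classVert
  rw [hclass]
  refine (ncard_extremePoints_biUnion_le _ F).trans (Finset.sum_le_sum fun v _ => ?_)
  rw [hFcoe v]
  unfold unionVert
  rw [ncard_extremePoints_vadd]

/-- **`T(a,b,c) ≤ ∑_{v ∈ c(G)} unionTotal a b (c⁻¹ v)`** (sum the level-set bound over the classes). [folklore] -/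
theorem totalVert_le_sum_unionTotal (a b c : G → (Fin 2 → ℝ)) [DecidableEq (Fin 2 → ℝ)] :
    totalVert a b c ≤ ∑ v ∈ Finset.univ.image c, unionTotal a b (c ⁻¹' {v}) := by
  unfold totalVert unionTotal
  rw [Finset.sum_comm]
  exact Finset.sum_le_sum fun s _ => classVert_le_sum_unionVert a b c s

/-- **The union totals law gives the `n = 3` law on the `m`-valued stratum with constant `m·C`**: if `c` takes at most `m`
values then `T(a,b,c) ≤ m·C·|G|²` (stated for label groups in `Type`, where the law is quantified). -/
theorem totalVert_le_of_unionTotalsLaw {C : ℕ} (h : UnionTotalsLaw C) {H : Type} [AddCommGroup H] [Fintype H]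
    (a b c : H → (Fin 2 → ℝ)) [DecidableEq (Fin 2 → ℝ)] {m : ℕ} (hm : (Finset.univ.image c).card ≤ m) :
    totalVert a b c ≤ m * C * Fintype.card H ^ 2 := by
  calc totalVert a b c ≤ ∑ v ∈ Finset.univ.image c, unionTotal a b (c ⁻¹' {v}) := totalVert_le_sum_unionTotal a b c
    _ ≤ ∑ _v ∈ Finset.univ.image c, C * Fintype.card H ^ 2 := Finset.sum_le_sum fun v _ => h H a b _
    _ = (Finset.univ.image c).card * (C * Fintype.card H ^ 2) := by rw [Finset.sum_const, smul_eq_mul]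
    _ ≤ m * (C * Fintype.card H ^ 2) := Nat.mul_le_mul_right _ hm
    _ = m * C * Fintype.card H ^ 2 := (mul_assoc _ _ _).symm

/-- **`UnionTotalsLaw C → TwoValuedTotalsLaw (2C)`.** -/
theorem twoValuedTotalsLaw_of_unionTotalsLaw {C : ℕ} (h : UnionTotalsLaw C) : TwoValuedTotalsLaw (2 * C) := by
  intro H _ _ a b c v₀ v₁ hc
  classical
  have hm : (Finset.univ.image c).card ≤ 2 := by
    have hsub : Finset.univ.image c ⊆ ({v₀, v₁} : Finset (Fin 2 → ℝ)) := by
      intro v hv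
      obtain ⟨z, -, rfl⟩ := Finset.mem_image.1 hv
      rcases hc z with hz | hz <;> simp [hz]
    exact (Finset.card_le_card hsub).trans (Finset.card_le_two)
  exact totalVert_le_of_unionTotalsLaw h a b c hm

/-- `TotalsLawThree C → TwoValuedTotalsLaw C` (restriction to the stratum). -/
theorem twoValuedTotalsLaw_of_totalsLawThree {C : ℕ} (h : TotalsLawThree C) : TwoValuedTotalsLaw C :=
  fun H _ _ a b c _ _ _ => h H a b c

end TotalsLaw

end Summit.ValiantsHypothesis.ValiantsHypothesis.Theorems.NewtonUnitEquationsDissociatedUniform
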